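import Literature.AnabelianGeometry.EtaleTheta.TemperedFrobenioidUnitToyCollapse
import Literature.AlgebraicGeometry.Frobenioids.ModelFrobenioidAutDescent
import Literature.AlgebraicGeometry.Frobenioids.ElementaryIsomorphisms
import HarnessLib

/-!
# [EtTh] Cor. 3.8 sub-DAG: row C38-L02b `PreservesPrimarySteps` (F-2810) is a SCHEMA over the typed Def. 3.6
# interface — its universal closure is refuted by the collapse equivalence `Φ = ℤ × ℕ ⥲ Φ = ℕ`

S. Mochizuki, *The étale theta function and its Frobenioid-theoretic manifestations*, Publ. RIMS **45** (2009)
[EtTh], Cor. 3.8, PDF pp. 80–81, proof p. 81 l.2–3: "In particular, by [Mzk17], Theorem 3.4, (ii); [Mzk17],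
Theorem 4.2, (i), it follows that `Ψ` preserves pre-steps and primary steps" [cite: MochizukiEtTh2009, Cor 3.8 p.81];
[FrdI] §0 p. 12 (primary elements), Def. 1.2 (iii) p. 22 (pre-steps, steps, primary steps), Thm. 5.2 pp. 100–101
[cite: MochizukiFrdI2008, Def. 1.2 (iii) p.22].

PROOF-ONLY companion (0 definitions) of abc-iut-w5-d124's statements-first sub-DAG file `TemperedFrobenioidCor38Sub.lean`,
row C38-L02b = `Cor38Hyp.PreservesPrimarySteps` (FACT-LIST F-2810; `preparatory`, parametrised over
`(T, D, VD, T', D', VD', C₁, C₂, h : Cor38Hyp C₁ C₂)`); abc-iut cell block F, seat abc-iut-f-135 (gen 2). Data: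
`TemperedFrobenioidUnitToyCollapse.lean` (`UnitToy.collapse`, `collapseEquiv`, `hypCollapse`, `Toy.primaryStep`).

WHY THE CLOSURE IS FALSE (an interface finding, not a statement about [EtTh]). The row quantifies over ALL
`h : Cor38Hyp C₁ C₂`, i.e. over every equivalence `Ψ` between the model categories of two tempered Frobenioids AS TYPED.
The typed Def. 3.6 (ii) carries "`Φ` divisorial" only as the free predicate `VD.IsDivisorialOn`, so both abc-iut-L2-t3's
`Toy.temperedFrobenioid` (`Φ = ℕ`, sharp) and gen 0's `UnitToy.frdFull` (`Φ = ℤ × ℕ`, unit `n₀ = (1,0)`) are admissible —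
and their categories are EQUIVALENT (`UnitToy.collapseEquiv`: in both, every hom-set is `ℕ_{≥1} × ℕ` with the law
`(d,z)·(d',z') = (dd', z'+d'z)` and all objects are isomorphic). But "primary step" ([FrdI] Def. 1.2 (iii): a pre-step
that is not an isomorphism and whose zero divisor is a primary element, §0: `a ≠ 0` and `b ≼ a ⇒ a ≼ b` for all `b ≠ 0`)
is not invariant under this equivalence:
* in `Toy` the endomorphism `(1, id, 𝔭, (1,𝔭))` of `(•,0)` is a primary step (`Toy.isStep_primaryStep`,
  `Toy.isPrimaryPreStep_primaryStep`: `𝔭 = 1 ∈ ℕ` is primary, and an isomorphism of a model Frobenioid has a unit as zero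
  divisor, which `𝔭` is not);
* in `frdFull` there are NO primary steps at all (`UnitToy.not_isStep_of_isPrimaryPreStep`): `n₀ ≼ a` for every `a`
  (a unit divides everything), so a primary `a` satisfies `a ≼ n₀`, i.e. `a ∣ n₀^n` is a UNIT (`UnitToy.isUnit_of_isPrimary`),
  and a linear base-isomorphism with unit zero divisor is an isomorphism (abc-iut-L1's `ModelFrobenioid.isIso_of_isUnit_div`).
Hence `Ψ⁻¹` (indeed ANY functor `Toy → frdFull`) cannot carry `Toy`'s primary step to a primary step:
`UnitToy.not_preservesPrimarySteps_of` (for EVERY `h : Cor38Hyp frdFull Toy.temperedFrobenioid`) and its mirror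
`Toy.not_preservesPrimarySteps_of` (every `h : Cor38Hyp Toy.temperedFrobenioid frdFull`), whence
**`Cor38Hyp.not_forall_preservesPrimarySteps`** (universe-`0` closure, binders = the row's own).
What the equivalence does NOT separate: it preserves Frobenius degrees and base maps, hence pre-steps, linear morphisms
and `O^▷(−)` — rows C38-L02a (F-2809), C38-L04 (F-2812), "preserves linear" (F-2815) are untouched by this datum.

INSTANCE FORMS (what print asserts, at the data the cone consumes) are in the tree and CITED, not restated:
`Cor38Hyp.preservesPrimarySteps_of_thm42i` (w5-d124, ⟸ [FrdI] Thm. 4.2 (i)), `preservesPrimarySteps_of_isFrobenioid_weak`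
(abc-iut-L2-d2, `Discharge/Sec3Cor38iiiOfIsFrobenioidWeak.lean`, modulo `hF_i : IsFrobenioid C_i.toElem` only),
`preservesPrimarySteps_of_preservesPreSteps` (`Discharge/Sec3Cor38iiiHolds.lean`), `preservesPrimarySteps_treeCatVocab`
(`Discharge/Sec3Cor38Thm34RowsTreeVocab.lean`). So the row is admissible AT NAMED INSTANCES ONLY (FACT-LIST class
«universal-closure REFUTED / schema; instance forms in tree»). HONEST FRAMING: bookkeeping about OUR typing; a refuted
closure says nothing about [EtTh] Cor. 3.8, whose `Φ` is divisorial (sharp) — exactly what `frdFull` violates by design;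
nothing here bears on [IUTchIII] Cor. 3.12; no side taken; typed ≠ proved.
-/

noncomputable section

namespace Literature.AnabelianGeometry.EtaleTheta

open CategoryTheory Opposite Literature.AlgebraicGeometry.Frobenioids

/-! ## `Toy` (`Φ = ℕ`): the endomorphism `(1, id, 𝔭, (1,𝔭))` of `(•,0)` is a primary step -/

namespace Toy

/-- `𝔭 = 1 ∈ ℕ = Φ(A)` is a primary element ([FrdI] §0: `𝔭 ≠ 0`, and `b ≼ 𝔭 ⇒ 𝔭 ≼ b` for `b ≠ 0` — indeed `𝔭 ∣ b`).
[cite: MochizukiFrdI2008, §0 p.12] -/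
theorem isPrimary_𝔭 (A : (Discrete PUnit.{1})ᵒᵖ) : IsPrimary (𝔭 A) := by
  refine ⟨fun h => ?_, fun b hb _ => ⟨1, Nat.one_pos, ?_⟩⟩
  · have h' := congrArg (fun x => Multiplicative.toAdd (ofΦ A x)) h
    simp [ofΦ_toΦ] at h'
  · -- `𝔭 ∣ b` for `b ≠ 0`: `b = 𝔭 · (b - 1)`
    have hb' : Multiplicative.toAdd (ofΦ A b) ≠ 0 := by
      intro h0
      apply hb
      apply ofΦ_injective A
      rw [map_one]
      exact Multiplicative.toAdd.injective h0
    refine ⟨toΦ A (Multiplicative.ofAdd (Multiplicative.toAdd (ofΦ A b) - 1)), ?_⟩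
    apply ofΦ_injective A
    rw [pow_one, map_mul, ofΦ_toΦ, ofΦ_toΦ]
    change ofΦ A b = Multiplicative.ofAdd (1 + (Multiplicative.toAdd (ofΦ A b) - 1))
    rw [Nat.add_sub_cancel' (Nat.one_le_iff_ne_zero.2 hb'), ofAdd_toAdd]

/-- `Φ(A) = ℕ` is sharp: its only unit is `0`. [cite: MochizukiFrdI2008, §0 p.10] -/
theorem eq_one_of_isUnit (A : (Discrete PUnit.{1})ᵒᵖ) {x : (temperedFrobenioid.divisorMonoid.obj A : Type)}
    (hx : IsUnit x) : x = 1 := by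
  obtain ⟨u, rfl⟩ := hx
  have h := congrArg (fun y => Multiplicative.toAdd (ofΦ A y)) u.mul_inv
  simp only [map_mul, toAdd_mul, map_one, toAdd_one, Nat.add_eq_zero_iff] at h
  apply ofΦ_injective A
  rw [map_one]
  exact Multiplicative.toAdd.injective h.1

/-- `primaryStep` is NOT an isomorphism: an isomorphism of the model Frobenioid has a unit as zero divisor, and `𝔭 ≠ 0`
in the sharp `ℕ`. [cite: MochizukiFrdI2008, Thm. 5.2(ii) p.101] -/
theorem not_isIso_primaryStep : ¬ IsIso primaryStep := by
  intro h
  have hu : IsUnit (ModelFrobenioid.div primaryStep) :=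
    ElemFrobenioid.isUnit_div_of_isIso (temperedFrobenioid.toElem.map primaryStep)
  exact (isPrimary_𝔭 (op pt)).1 (eq_one_of_isUnit _ hu)

/-- `primaryStep` is a pre-step (linear base-isomorphism). [cite: MochizukiFrdI2008, Def. 1.2 (iii) p.22] -/
theorem isPreStep_primaryStep : temperedFrobenioid.opsData.IsPreStep primaryStep :=
  ⟨rfl, (inferInstance : IsIso (𝟙 pt))⟩

/-- **`primaryStep` is a step** (a pre-step that is not an isomorphism). [cite: MochizukiFrdI2008, Def. 1.2 (iii) p.22] -/
theorem isStep_primaryStep : temperedFrobenioid.opsData.IsStep primaryStep :=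
  ⟨isPreStep_primaryStep, not_isIso_primaryStep⟩

/-- **`primaryStep` is a primary pre-step** (zero divisor the primary element `𝔭`). [cite: MochizukiFrdI2008, Def. 1.2 (iii) p.22] -/
theorem isPrimaryPreStep_primaryStep : temperedFrobenioid.opsData.IsPrimaryPreStep primaryStep :=
  ⟨isPreStep_primaryStep, isPrimary_𝔭 (op pt)⟩

end Toy

/-! ## `frdFull` (`Φ = ℤ × ℕ`): there are no primary steps -/

namespace UnitToy

/-- In `Φ(A) = ℤ × ℕ` a primary element is a UNIT: the unit `n₀ = (1,0) ≠ 0` satisfies `n₀ ≼ a`, so primality gives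
`a ≼ n₀`, i.e. `a ∣ n₀^n`, a unit ([FrdI] §0). [cite: MochizukiFrdI2008, §0 p.12] -/
theorem isUnit_of_isPrimary (A : (Discrete PUnit.{1})ᵒᵖ) {a : (frdFull.divisorMonoid.obj A : Type)} (ha : IsPrimary a) :
    IsUnit a := by
  have hn₀ : IsUnit (n₀Φ A) := IsUnit.of_mul_eq_one _ (n₀Φ_mul_n₀invΦ A)
  have hne : n₀Φ A ≠ 1 := by
    intro h
    have h' := congrArg (fun x : (frdFull.divisorMonoid.obj A : Type) => Multiplicative.toAdd x.1.1) h
    change Multiplicative.toAdd (Multiplicative.ofAdd (1 : ℤ)) = Multiplicative.toAdd (1 : Multiplicative ℤ) at h'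
    simp at h'
  obtain ⟨n, -, hdvd⟩ := ha.2 (n₀Φ A) hne ⟨1, Nat.one_pos, hn₀.dvd⟩
  exact isUnit_of_dvd_unit hdvd (hn₀.pow n)

/-- **`frdFull` has no primary steps**: a pre-step with primary, hence unit, zero divisor is an isomorphism
(abc-iut-L1's `ModelFrobenioid.isIso_of_isUnit_div`; `B` group-like), so it is not a step. [cite: MochizukiFrdI2008, Def. 1.2 (iii) p.22] -/
theorem not_isStep_of_isPrimaryPreStep {X Y : frdFull.category} (ψ : X ⟶ Y)
    (hψ : frdFull.opsData.IsPrimaryPreStep ψ) : ¬ frdFull.opsData.IsStep ψ := by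
  rintro ⟨-, hniso⟩
  obtain ⟨⟨hlin, hbi⟩, hprim⟩ := hψ
  haveI : IsIso (ModelFrobenioid.baseMap ψ) := hbi
  exact hniso (ModelFrobenioid.isIso_of_isUnit_div (hBg ⊤ (Submonoid.mem_top _)) ψ (isUnit_of_isPrimary _ hprim) hlin)

/-- **Row C38-L02b / F-2810 fails for EVERY `h : Cor38Hyp frdFull Toy.temperedFrobenioid`** (in particular for
`hypCollapse`): `Ψ⁻¹` would have to carry `Toy.primaryStep` to a primary step of `frdFull`, and there is none.
[cite: MochizukiEtTh2009, Cor 3.8 p.81] -/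
theorem not_preservesPrimarySteps_of (h : Cor38Hyp frdFull Toy.temperedFrobenioid) : ¬ h.PreservesPrimarySteps :=
  fun hP =>
    have himg := hP.2 Toy.primaryStep ⟨Toy.isStep_primaryStep, Toy.isPrimaryPreStep_primaryStep⟩
    not_isStep_of_isPrimaryPreStep _ himg.2 himg.1

/-- **Row C38-L02b / F-2810 fails at `hypCollapse`.** [cite: MochizukiEtTh2009, Cor 3.8 p.81] -/
theorem not_preservesPrimarySteps : ¬ hypCollapse.PreservesPrimarySteps :=
  not_preservesPrimarySteps_of hypCollapse

/-- The record `Cor38Hyp frdFull Toy.temperedFrobenioid` is inhabited (by `hypCollapse`), so the failure above is not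
vacuous. [cite: MochizukiEtTh2009, Cor 3.8 p.80] -/
theorem nonempty_cor38Hyp_frdFull_toy : Nonempty (Cor38Hyp frdFull Toy.temperedFrobenioid) := ⟨hypCollapse⟩

end UnitToy

namespace Toy

/-- The mirror: **row C38-L02b fails for EVERY `h : Cor38Hyp Toy.temperedFrobenioid frdFull`** (`Ψ` itself would have
to carry `primaryStep` to a primary step of `frdFull`). [cite: MochizukiEtTh2009, Cor 3.8 p.81] -/
theorem not_preservesPrimarySteps_of (h : Cor38Hyp temperedFrobenioid UnitToy.frdFull) : ¬ h.PreservesPrimarySteps :=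
  fun hP =>
    have himg := hP.1 primaryStep ⟨isStep_primaryStep, isPrimaryPreStep_primaryStep⟩
    UnitToy.not_isStep_of_isPrimaryPreStep _ himg.2 himg.1

/-- … and that record is inhabited too (by `collapseEquiv.symm`). [cite: MochizukiEtTh2009, Cor 3.8 p.80] -/
theorem nonempty_cor38Hyp_toy_frdFull : Nonempty (Cor38Hyp temperedFrobenioid UnitToy.frdFull) :=
  ⟨⟨UnitToy.collapseEquiv.symm, ⟨ArchFrd.isOfFSMFFType_discretePUnit, ArchFrd.isOfFSMFFType_discretePUnit⟩,
    ⟨fun _ _ => trivial, fun _ _ => trivial⟩⟩⟩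

end Toy

/-! ## The universal closure of the row is false -/

namespace Cor38Hyp

/-- **F-2810 (`PreservesPrimarySteps`, row C38-L02b) — universal closure REFUTED over the typed interface**: at the pair
(`UnitToy.frdFull` : `Φ = ℤ × ℕ` with a unit, `Toy.temperedFrobenioid` : `Φ = ℕ` sharp), whose model categories are
equivalent (`UnitToy.collapseEquiv`), `Toy` has the primary step `(1, id, 𝔭, (1,𝔭))` while `frdFull` has no primary step
at all (primary ⇒ unit ⇒ isomorphism). The row holds at the data the cone consumes (`preservesPrimarySteps_of_thm42i`,
`preservesPrimarySteps_of_isFrobenioid_weak`, [FrdI] Thm. 4.2 (i)); print's `Φ` is divisorial, hence sharp.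
[cite: MochizukiEtTh2009, Cor 3.8 p.81] -/
theorem not_forall_preservesPrimarySteps :
    ¬ ∀ (D₀ : Type) (_ : Category.{0} D₀) (V : FrdIMonoidStub.{0}) (T : RealifiedDivisorMonoids (D₀ := D₀) V)
        (D : Type) (_ : Category.{0} D) (VD : FrdICatStub.{0, 0, 0} D)
        (D₀' : Type) (_ : Category.{0} D₀') (T' : RealifiedDivisorMonoids (D₀ := D₀') V)
        (D' : Type) (_ : Category.{0} D') (VD' : FrdICatStub.{0, 0, 0} D')
        (C₁ : TemperedFrobenioid T D VD) (C₂ : TemperedFrobenioid T' D' VD') (h : Cor38Hyp C₁ C₂),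
        h.PreservesPrimarySteps := fun H =>
  UnitToy.not_preservesPrimarySteps (H _ _ _ _ _ _ _ _ _ _ _ _ _ _ _ UnitToy.hypCollapse)

end Cor38Hyp

end Literature.AnabelianGeometry.EtaleTheta

end
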